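import Literature.Geometry.Riemannian.GradientShrinkerProofs
import HarnessLib

/-!
# `∫(R − 2)² dV = ∫|∇f|²(3 − R) dV` on a closed normalised four-dimensional gradient shrinker
(stub `stub_variance_eq_gradSq_mul` of line `cgy-variance-pivot`, crux
`EntropyRung.CompactShrinkerGap`, item stmt-SmoothPoincare4-10870)

For a Riemannian metric `g` (Levi-Civita connection) on a closed `4`-manifold and a smooth `f`
with `Ric + Hess f = g/2` and the normalisation `R + |∇f|² = f` (a normalised gradient shrinker,
`τ = 1`), the variance of the scalar curvature about its mean `2` is located by the dictionary
identity

  `∫_M (R − 2)² dV = ∫_M |∇f|² (3 − R) dV`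

(so regions with `R > 3` contribute negatively; with `R > 0` it gives the sufficient condition
`∫|∇f|² < (2 Vol − 96π²)/3` for the Chang–Gursky–Yang variance budget).

Proof (measure/integral bookkeeping only, all integrands continuous on a compact manifold of
finite volume; no Bochner formula is needed): write `V = Vol(M, g)`.
1. The trace `R + Δf = 2` of the soliton equation
   (`IsGradientShrinker.scalarCurvature_add_dalembertian_one`, `finrank ℝ ℝ⁴ = 4`) and `∫Δf dV = 0`
   (`integral_dalembertian_riemVolume_eq_zero`) give `∫R = 2V`.
2. Green's first identity with `u = v = f` (`integral_mul_dalembertian_riemVolume`):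
   `∫ f Δf = −∫ g⁻¹(df, df) = −∫|∇f|²`, and `Δf = 2 − R`, `|∇f|² = f − R` (normalisation) give
   `2∫f − ∫fR = −∫f + ∫R`, i.e. `∫fR = 3∫f − 2V`.
3. Expand: `∫|∇f|²(3 − R) = ∫(f − R)(3 − R) = 3∫f − 3∫R − ∫fR + ∫R² = ∫R² − 4V` and
   `∫(R − 2)² = ∫R² − 4∫R + 4V = ∫R² − 4V`.

Sanity check: the round `S⁴(√6)` with `f ≡ 2 = R`, `∇f = 0`: both sides are `0`.
Everything is proved; no definition, no named fact.

References: H.-D. Cao, M. Zhu, arXiv:1008.0842, (3.6)–(3.7) [CaoZhu2010]; X. Cheng,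
E. Ribeiro Jr, D. Zhou, arXiv:2203.14916, Lemma 1 and p. 5 [ChengRibeiroZhou2022];
J. A. Carrillo, L. Ni, Comm. Anal. Geom. 17 (2009), §2 (2.1)–(2.3) [CarrilloNi2009];
J. M. Lee, *Introduction to Riemannian Manifolds* (2018), Problem 2-23 [Lee2018].
-/

noncomputable section

-- the registered namespace `Summit.SmoothPoincare4.SmoothPoincare4.Theorems` repeats a component
set_option linter.dupNamespace false

open Bundle Set Function Filter Module MeasureTheory
open scoped Manifold ContDiff Topology

namespace Summit.SmoothPoincare4.SmoothPoincare4.Theorems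

open Literature.Geometry Literature.Geometry.Lorentzian Literature.Geometry.Riemannian
  Literature.Geometry.Lorentzian.PseudoRiemannianMetric

/-- **STUB `stub_variance_eq_gradSq_mul` of line `cgy-variance-pivot` — the variance of the
scalar curvature of a closed normalised 4-d gradient shrinker in terms of the Dirichlet energy of
the potential.** For `g` Riemannian (Levi-Civita) on a closed 4-manifold and `f` smooth with
`Ric + Hess f = g/2`, `R + |∇f|² = f`: `∫(R − 2)² dV = ∫|∇f|²(3 − R) dV`. Proof: `R + Δf = 2`
(`IsGradientShrinker.scalarCurvature_add_dalembertian_one`, `finrank = 4`) and `∫Δf = 0`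
(`integral_dalembertian_riemVolume_eq_zero`) give `∫R = 2V`; Green's first identity
`∫ f Δf = −∫|∇f|²` (`integral_mul_dalembertian_riemVolume`, `u = v = f`) with `Δf = 2 − R` and
`|∇f|² = f − R` gives `∫fR = 3∫f − 2V`; then both sides expand to `∫R² − 4V`. Check: round
`S⁴(√6)`, `f ≡ 2 = R`: `0 = 0`.
[cite: CaoZhu2010, (3.6)–(3.7)] [cite: ChengRibeiroZhou2022, Lemma 1 and p. 5]
[cite: Lee2018, Problem 2-23 (a)] -/
theorem stub_variance_eq_gradSq_mul :
    ∀ (M : Type) [TopologicalSpace M] [T2Space M] [SecondCountableTopology M]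
      [ChartedSpace (EuclideanSpace ℝ (Fin 4)) M] [IsManifold (𝓡 4) ∞ M] [CompactSpace M]
      [T3Space M] [MeasurableSpace M] [BorelSpace M]
      (g : Literature.Geometry.Lorentzian.PseudoRiemannianMetric (𝓡 4) ∞ (EuclideanSpace ℝ (Fin 4))
        (TangentSpace (𝓡 4) : M → Type _)) [g.HasLeviCivita] (f : M → ℝ) (hg : g.IsRiemannian),
      ContMDiff (𝓡 4) 𝓘(ℝ, ℝ) ∞ f →
      (∀ (x : M) (X Y : TangentSpace (𝓡 4) x),
        g.ricci x X Y + g.hessian f x X Y = (1 / 2 : ℝ) * g.val x X Y) →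
      (∀ x : M, g.scalarCurvature x + g.gradSq f x = f x) →
      ∫ x, (g.scalarCurvature x - 2) ^ 2
          ∂(Literature.Geometry.Lorentzian.riemannianMeasure (g.toContMDiffRiemannianMetric hg)) =
        ∫ x, g.gradSq f x * (3 - g.scalarCurvature x)
          ∂(Literature.Geometry.Lorentzian.riemannianMeasure (g.toContMDiffRiemannianMetric hg)) := by
  intro M _ _ _ _ _ _ _ _ _ g _ f hg hf hsol hnorm
  -- the Riemannian measure is `g.riemVolume`, a finite measure
  have hV : g.riemVolume = riemannianMeasure (g.toContMDiffRiemannianMetric hg) :=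
    PseudoRiemannianMetric.riemVolume_eq hg
  haveI : IsFiniteMeasure g.riemVolume := ⟨g.riemVolume_univ_lt_top⟩
  have hE : finrank ℝ (EuclideanSpace ℝ (Fin 4)) = 4 := finrank_euclideanSpace_fin
  rw [← hV]
  -- regularity of `R` and `f`
  have hRc : Continuous g.scalarCurvature := g.contMDiff_scalarCurvature.continuous
  have hfc : Continuous f := hf.continuous
  have hf1 : ContMDiff (𝓡 4) 𝓘(ℝ, ℝ) 1 f := hf.of_le (by norm_num)
  have hf2 : ContMDiff (𝓡 4) 𝓘(ℝ, ℝ) 2 f := hf.of_le (WithTop.coe_le_coe.mpr le_top)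
  -- the normalisation: `|∇f|² = f − R`
  have hG : ∀ x, g.gradSq f x = f x - g.scalarCurvature x := fun x ↦ by linarith [hnorm x]
  -- integrability of the (continuous) integrands for the finite measure `dV_g`
  have iR : Integrable g.scalarCurvature g.riemVolume := g.integrable_of_continuous hRc
  have iR2 : Integrable (fun x ↦ g.scalarCurvature x ^ 2) g.riemVolume :=
    g.integrable_of_continuous (hRc.pow 2)
  have iF : Integrable f g.riemVolume := g.integrable_of_continuous hfc
  have iFR : Integrable (fun x ↦ f x * g.scalarCurvature x) g.riemVolume :=
    g.integrable_of_continuous (hfc.mul hRc)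
  have i2F : Integrable (fun x ↦ 2 * f x) g.riemVolume := iF.const_mul 2
  have i3F : Integrable (fun x ↦ 3 * f x) g.riemVolume := iF.const_mul 3
  have i3R : Integrable (fun x ↦ 3 * g.scalarCurvature x) g.riemVolume := iR.const_mul 3
  have i4R : Integrable (fun x ↦ 4 * g.scalarCurvature x) g.riemVolume := iR.const_mul 4
  -- the traced soliton equation `R + Δf = 2`
  have hshr : g.IsGradientShrinker f 1 := (g.isGradientShrinker_one_iff f).2 hsol
  have hΔf : ∀ x, g.dalembertian f x = 2 - g.scalarCurvature x := fun x ↦ by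
    have h := hshr.scalarCurvature_add_dalembertian_one x
    rw [hE] at h
    norm_num at h
    linarith
  -- (1) `∫ Δf = 0`, i.e. `∫ R = 2 Vol`
  have e1 : ∫ x, g.scalarCurvature x ∂g.riemVolume = 2 * (g.riemVolume univ).toReal := by
    have h0 := integral_dalembertian_riemVolume_eq_zero g hg hf2
    simp_rw [hΔf] at h0
    rw [integral_sub (integrable_const _) iR, integral_const, smul_eq_mul, Measure.real] at h0
    linarith
  -- (2) Green with `u = v = f`: `∫ f Δf = −∫ |∇f|²`, i.e. `2∫f − ∫fR = −(∫f − ∫R)`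
  have e2 : 2 * ∫ x, f x ∂g.riemVolume - ∫ x, f x * g.scalarCurvature x ∂g.riemVolume =
      -(∫ x, f x ∂g.riemVolume - ∫ x, g.scalarCurvature x ∂g.riemVolume) := by
    have h0 : ∫ x, f x * g.dalembertian f x ∂g.riemVolume = -∫ x, g.gradSq f x ∂g.riemVolume :=
      integral_mul_dalembertian_riemVolume g hg hf1 hf2
    simp_rw [hΔf, hG] at h0
    have h1 : (fun x ↦ f x * (2 - g.scalarCurvature x)) =
        fun x ↦ 2 * f x - f x * g.scalarCurvature x := by
      funext x
      ring
    rwa [h1, integral_sub i2F iFR, integral_const_mul, integral_sub iF iR] at h0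
  -- (3) `∫ |∇f|²(3 − R) = ∫ (f − R)(3 − R) = (3∫f − 3∫R) − (∫fR − ∫R²)`
  have e3 : ∫ x, g.gradSq f x * (3 - g.scalarCurvature x) ∂g.riemVolume =
      3 * ∫ x, f x ∂g.riemVolume - 3 * ∫ x, g.scalarCurvature x ∂g.riemVolume -
        (∫ x, f x * g.scalarCurvature x ∂g.riemVolume -
          ∫ x, g.scalarCurvature x ^ 2 ∂g.riemVolume) := by
    have h1 : (fun x ↦ g.gradSq f x * (3 - g.scalarCurvature x)) =
        fun x ↦ (3 * f x - 3 * g.scalarCurvature x) -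
          (f x * g.scalarCurvature x - g.scalarCurvature x ^ 2) := by
      funext x
      rw [hG x]
      ring
    have i₁ : Integrable (fun x ↦ 3 * f x - 3 * g.scalarCurvature x) g.riemVolume := i3F.sub i3R
    have i₂ : Integrable (fun x ↦ f x * g.scalarCurvature x - g.scalarCurvature x ^ 2)
        g.riemVolume := iFR.sub iR2
    rw [h1, integral_sub i₁ i₂, integral_sub i3F i3R, integral_sub iFR iR2, integral_const_mul,
      integral_const_mul]
  -- (4) `∫ (R − 2)² = ∫R² − 4∫R + 4 Vol`
  have e4 : ∫ x, (g.scalarCurvature x - 2) ^ 2 ∂g.riemVolume =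
      ∫ x, g.scalarCurvature x ^ 2 ∂g.riemVolume - 4 * ∫ x, g.scalarCurvature x ∂g.riemVolume +
        4 * (g.riemVolume univ).toReal := by
    have h1 : (fun x ↦ (g.scalarCurvature x - 2) ^ 2) =
        fun x ↦ g.scalarCurvature x ^ 2 - 4 * g.scalarCurvature x + 4 := by
      funext x
      ring
    have i₁ : Integrable (fun x ↦ g.scalarCurvature x ^ 2 - 4 * g.scalarCurvature x)
        g.riemVolume := iR2.sub i4R
    rw [h1, integral_add i₁ (integrable_const _), integral_sub iR2 i4R, integral_const_mul,
      integral_const, smul_eq_mul, Measure.real]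
    ring
  rw [e3, e4]
  linarith [e1, e2]

end Summit.SmoothPoincare4.SmoothPoincare4.Theorems

end
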